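/-
Copyright (c) 2026 the pub-hodgecm-mathlib formalisation cell (harness21).  Prover seat hodgecm-mathlib-K2Liu-p09 (g4): Track B «K2-LIT», #184♮ = hLiu418,
file #34 `Theorems/K2LiuDoublingZetaGL1.lean` — THE ASSEMBLY FROM THE LOCAL DATA (DEPMAP v2.9 §10 TABLE B; PLAN-O7 steps 8–12).
-/
import Summits.HodgeConjecture.HodgeConjecture.Theorems.K2LiuDoublingZetaGL1Unfold          -- ★ (g2): ★ #13 with L² slots, twist cancelled
import Summits.HodgeConjecture.HodgeConjecture.Theorems.K2LiuDoublingZetaGL1Majorant        -- ★ O1 (p857130)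
import Summits.HodgeConjecture.HodgeConjecture.Theorems.K2LiuDoublingZetaGL1Factor          -- ★ (g2): (F) of ★ #29s from `IsFactorizableOff`
import Summits.HodgeConjecture.HodgeConjecture.Theorems.K2LiuDoublingZetaGL1Assemble        -- ★ (g2): `assemble_witnesses`
import Summits.HodgeConjecture.HodgeConjecture.Theorems.K2LiuDoublingZetaGL1Anisotropic     -- ★ (an) (p857622)
import Summits.HodgeConjecture.HodgeConjecture.Theorems.K2LiuDoublingZetaGL1Character       -- ★ O5 (p857472): `Ψ`
import Summits.HodgeConjecture.HodgeConjecture.Theorems.K2LiuDoublingZetaGL1LambdaProd      -- ★ O4b (p857488)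
import Summits.HodgeConjecture.HodgeConjecture.Theorems.K2LiuDoublingZetaGL1LambdaSplit     -- ★ O4 (p857152): the universal constant
import Summits.HodgeConjecture.HodgeConjecture.Theorems.K2LiuDoublingZetaGL1LambdaInert     -- ★ O4-inert (p857515): the universal constant
import Summits.HodgeConjecture.HodgeConjecture.Theorems.K2LiuDoublingZetaGL1Level           -- ★ (p857758): the translated slot
import Summits.HodgeConjecture.HodgeConjecture.Theorems.K2LiuDoublingPartialEuler           -- ★ #29s (g2)
import Summits.HodgeConjecture.HodgeConjecture.Theorems.K2LiuThetaTypeDoublingEulerFactorGL1  -- ★ #30s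
import Summits.HodgeConjecture.HodgeConjecture.Theorems.K2LiuStdFamilyFactorisable          -- ★ #31s
import Summits.HodgeConjecture.HodgeConjecture.Theorems.K2LiuIwasawaHeightContinuous        -- ★ #31c
import Summits.HodgeConjecture.HodgeConjecture.Theorems.K2LiuZetaSHolomorphic               -- ★ #32s
import Summits.HodgeConjecture.HodgeConjecture.Theorems.K2LiuSiegelDeltaHeightExists        -- ★ #15a: a height of type `(P_Δ, modDelta)`
import Summits.HodgeConjecture.HodgeConjecture.Theorems.K2LiuSiegelEisensteinDoubledSummable -- ★ #9
import Summits.HodgeConjecture.HodgeConjecture.Theorems.K2LiuDoublingSectionIntegrable      -- ★ #14a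
import Summits.HodgeConjecture.HodgeConjecture.Theorems.K2LiuDoublingUnfoldBridge           -- ★ `exists_continuousMulEquiv_eq_iotaA`
import Literature.NumberTheory.K2Lit.SiegelStandardExtension                                -- ★ `stdExtension`
import Literature.NumberTheory.K2Lit.SiegelStandardIwasawaData                              -- ★ `IwasawaDatum.IsStd`
import HarnessLib

/-!
# Crux `HLiu418`, Track B road `K2_Liu`, file #34 — `DoublingZetaGL1` FROM THE LOCAL DATA OF THE SEAM

Cell `hodgecm-mathlib`, crux item hLiu418 = `stmt-HodgeConjecture-24832`, route of record `HCCMUnconditional`; squad K2 ∕ K2Liu, prover K2Liu-p09 (g4).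
THEOREMS ONLY (no `def`, no instance, no notation, no named-fact hypothesis, no `sorry`); lane `--supports stmt-HodgeConjecture-24832 --as helper`.

`doublingZetaGL1_of_localData` — **the analytic assembly of s23's conclusion** for a discrete automorphic `P` of `U(H)`, GIVEN: the typed sockets #32dR and #33s
BY VALUE, a finite set `S` of places of `L⁺` off which `λ̃, λ̃⁻¹, χ̌` are unramified, a normalised Haar family `(ν_v)` on the `U(H)(L⁺_v)`, a vector `w ∈ P` with
continuous companion `wc ≠ 0` (`w =ᵐ wc`) fixed by `K^S`, and at every `v ∉ S` the LOCAL DATUM of ★ `K2LiuDoublingZetaGL1Local.local_datum` ((Λ_K), (Iw), (Λ), `Θ₁, Θ₂`,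
(E)_v+(H)_v for every second slot).  THEN the conclusion of tier-0 rev. l `DoublingZetaGL1` for `P` (BY VALUE): `(𝒦, f, w, w', ψ, S_L, r, U, s₁)` with
`Z(s) = r(s) · ζ^S_L(s+½) L^S(s+½, ψ)` for `Re s > s₁`.
Chain: (an) ★ anisotropy → ★ #13 (`doublingUnfold_ae_twist`) → ★ #29s (`doublingPartialEuler`: (F) ★ #31s + ★ `factorizable_pullback`, (Λ) the datum + ★ O4b, (I) ★ #14a along
★ `exists_continuousMulEquiv_eq_iotaA`, (K) the `K^S`-fixed `w`, (E) the datum with `c_v(s) :=` closed form ∕ cleared (H)) → ★ #30s (`ψ := Ψ = λ̃⁻¹λ̃ᶜχ̌`, ★ O5) →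
★ `assemble_witnesses` with ★ #32s (decay = #32dR) and #33s (`Z_S(½) ≠ 0`, `𝒦` standard, `f := stdExtension 𝒦 ½ φ` ★, continuity ★ #31c, summability ★ #9, majorant ★ O1).

HONEST LABEL: HC_CM is proved only modulo the printed citations (2 remaining named inputs: hLiu418 = stmt-HodgeConjecture-24832,
h413 = stmt-HodgeConjecture-24833) until rung 0 closes; this file is bookkeeping toward socket s23 and closes no item (the sockets #32dR, #33s stay hypotheses).
References: [Liu2021] App. B Thm. B.4, Lem. B.11–B.12, App. D proof of Lem. D.1; [Li1992] §3 Thm. 3.1; [Liu2011] §2B–§2C; [HarrisKudlaSweet1996] §1, §6;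
[GelbartPiatetskishapiroRallis1987] Part A §1, §6.
-/

set_option autoImplicit false
set_option linter.dupNamespace false

noncomputable section

open NumberField NumberField.InfinitePlace MeasureTheory IsDedekindDomain
open scoped Matrix ComplexOrder ENNReal InnerProductSpace ComplexConjugate
open scoped NNReal Topology RestrictedProduct
open Literature.NumberTheory.Automorphic Literature.NumberTheory.Automorphic.UnitaryGroup
open Literature.NumberTheory.Automorphic.IdeleClassGroup
open Literature.NumberTheory.Automorphic.Liu2021
open Literature.NumberTheory.Automorphic.Liu2021.Def411WeilCarriers
open Literature.NumberTheory.GaloisRepresentations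
open Literature.NumberTheory.GelbartRogawski1991 Literature.NumberTheory.GelbartRogawski1991.GRConstruction
open Literature.NumberTheory.K2Lit Literature.NumberTheory.K2Lit.SiegelDoubled Literature.NumberTheory.K2Lit.PlaceSplitting
open Literature.AlgebraicGeometry.ShimuraVarieties (hermForm)
open Filter Set
open Summit.HodgeConjecture.HodgeConjecture.Cruxes.HLiu418
open Summit.HodgeConjecture.HodgeConjecture.Cruxes.HLiu418.K2LiuDoublingZetaGL1Docking
open Summit.HodgeConjecture.HodgeConjecture.Cruxes.HLiu418.K2LiuDoublingZetaGL1LambdaSplit (exists_integral_norm_lambdaLoc_le)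
open Summit.HodgeConjecture.HodgeConjecture.Cruxes.HLiu418.K2LiuDoublingZetaGL1LambdaInert (exists_integral_norm_lambdaLoc_le_inert)

namespace Summit.HodgeConjecture.HodgeConjecture.Cruxes.HLiu418.K2LiuDoublingZetaGL1Euler

set_option maxHeartbeats 4000000 in -- the two sockets by value, the local datum and s23's conclusion in ONE statement; the assembly proof
/-- **`DoublingZetaGL1` (s23, BY VALUE) FROM THE LOCAL DATA OF THE SEAM** — see the module docstring for the inputs and the chain.
[cite: Liu2021, App. B Thm. B.4 (1) (p. 98); Lem. B.11–B.12 (p. 102–103); proof of Lem. D.1 (p. 126 L8–13)] [cite: HarrisKudlaSweet1996, §1, §6]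
[cite: Li1992, §3 Thm. 3.1] [cite: Liu2011, §2B Prop. 2.3, §2C (2-4)] [cite: GelbartPiatetskishapiroRallis1987, Part A §1, §6] -/
theorem doublingZetaGL1_of_localData
    (h32dR : ∀ (L : Type) [Field L] [NumberField L] [IsCMField L] {n : ℕ} (e : Fin 2 × Fin 1 ≃ Fin n) (dV : Fin 2 → L) (hdV : ∀ i, IsCMField.complexConj L (dV i) = dV i) (_hdV0 : ∀ i, dV i ≠ 0) (ι : L →+* ℂ) (_hpos : ∀ τ' : L →+* ℂ, InfinitePlace.mk τ' ≠ InfinitePlace.mk ι → ((Matrix.diagonal dV).map τ').PosDef)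
      (dW : Fin 1 → L) (hdW : ∀ i, IsCMField.complexConj L (dW i) = dW i) (_hdW0 : ∀ i, dW i ≠ 0) (H : Matrix (Fin 2) (Fin 2) L) (t : L) (_ht : t ≠ 0) (g : GL (Fin 2) L) (_hg : formCongr ((IsCMField.complexConj L : L ≃ₐ[↥(maximalRealSubfield L)] L) : L →+* L) g (t • H) = Matrix.diagonal dV)
      (ιA : (UnitaryGroup.adelicGroupData (Fp L) L (IsCMField.complexConj L) 2 H).Adelic →* UnitaryGroup.adelic (Fp L) L (IsCMField.complexConj L) 2 (Matrix.diagonal dV)) (_hιA : ∀ k, ((ιA k : ↥(UnitaryGroup.adelic (Fp L) L (IsCMField.complexConj L) 2 (Matrix.diagonal dV))) : GL (Fin 2) (AdeleRing (𝓞 L) L)) =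
      (toAdeleGL L g)⁻¹ * UnitaryGroup.adelicVal (Fp L) L (IsCMField.complexConj L) 2 H k * toAdeleGL L g) (S : Finset (HeightOneSpectrum (𝓞 (Fp L)))) [DecidableEq (HeightOneSpectrum (𝓞 (Fp L)))]
      [MeasurableSpace (UnitaryGroup.arch (Fp L) L (IsCMField.complexConj L) 2 H)] [BorelSpace (UnitaryGroup.arch (Fp L) L (IsCMField.complexConj L) 2 H)] [∀ v : HeightOneSpectrum (𝓞 (Fp L)), MeasurableSpace (UnitaryGroup.localPi L (IsCMField.complexConj L) 2 H v)]
      [∀ v : HeightOneSpectrum (𝓞 (Fp L)), BorelSpace (UnitaryGroup.localPi L (IsCMField.complexConj L) 2 H v)] (νinf : Measure (UnitaryGroup.arch (Fp L) L (IsCMField.complexConj L) 2 H)) [νinf.IsHaarMeasure]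
      (νS : ∀ v : S, Measure (UnitaryGroup.localPi L (IsCMField.complexConj L) 2 H v.1)) [∀ v, (νS v).IsHaarMeasure] (Φ : HA L e dV hdV dW hdW → ℝ) (_hΦc : Continuous Φ) (_hΦpos : ∀ x, 0 < Φ x) (_hΦ : ∀ p x : HA L e dV hdV dW hdW, IsSiegelDelta L e dV hdV dW hdW p → Φ (p * x) = modDelta L e dV hdV dW hdW p * Φ x)
      (τ : ℝ) (_hτ : 2 * (2 : ℝ) - 2 < τ), Integrable (fun x => Φ (iotaLeft L e dV hdV dW hdW (ιA (placesEmbed L H S x))) ^ τ) (νinf.prod (Measure.pi νS)))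
    (h33s : ∀ (L : Type) [Field L] [NumberField L] [IsCMField L] {N n : ℕ} (e : Fin N × Fin 1 ≃ Fin n) (dV : Fin N → L) (hdV : ∀ i, IsCMField.complexConj L (dV i) = dV i) (_hdV0 : ∀ i, dV i ≠ 0)
      (dW : Fin 1 → L) (hdW : ∀ i, IsCMField.complexConj L (dW i) = dW i) (_hdW0 : ∀ i, dW i ≠ 0) (H : Matrix (Fin N) (Fin N) L) (t : L) (_ht : t ≠ 0) (g : GL (Fin N) L) (_hg : formCongr ((IsCMField.complexConj L : L ≃ₐ[↥(maximalRealSubfield L)] L) : L →+* L) g (t • H) = Matrix.diagonal dV)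
      (ιA : (UnitaryGroup.adelicGroupData (Fp L) L (IsCMField.complexConj L) N H).Adelic →* UnitaryGroup.adelic (Fp L) L (IsCMField.complexConj L) N (Matrix.diagonal dV)) (_hιA : ∀ k, ((ιA k : ↥(UnitaryGroup.adelic (Fp L) L (IsCMField.complexConj L) N (Matrix.diagonal dV))) : GL (Fin N) (AdeleRing (𝓞 L) L)) =
      (toAdeleGL L g)⁻¹ * UnitaryGroup.adelicVal (Fp L) L (IsCMField.complexConj L) N H k * toAdeleGL L g) (S : Finset (HeightOneSpectrum (𝓞 (Fp L)))) [DecidableEq (HeightOneSpectrum (𝓞 (Fp L)))]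
      [MeasurableSpace (UnitaryGroup.arch (Fp L) L (IsCMField.complexConj L) N H)] [BorelSpace (UnitaryGroup.arch (Fp L) L (IsCMField.complexConj L) N H)] [∀ v : HeightOneSpectrum (𝓞 (Fp L)), MeasurableSpace (UnitaryGroup.localPi L (IsCMField.complexConj L) N H v)]
      [∀ v : HeightOneSpectrum (𝓞 (Fp L)), BorelSpace (UnitaryGroup.localPi L (IsCMField.complexConj L) N H v)] (νinf : Measure (UnitaryGroup.arch (Fp L) L (IsCMField.complexConj L) N H)) [νinf.IsHaarMeasure] (νS : ∀ v : S, Measure (UnitaryGroup.localPi L (IsCMField.complexConj L) N H v.1)) [∀ v, (νS v).IsHaarMeasure]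
      (μ : Measure (UnitaryGroup.adelicGroupData (Fp L) L (IsCMField.complexConj L) N H).automorphicQuotient) [(UnitaryGroup.adelicGroupData (Fp L) L (IsCMField.complexConj L) N H).IsAutomorphicMeasure μ]
      [CompactSpace (UnitaryGroup.adelicGroupData (Fp L) L (IsCMField.complexConj L) N H).automorphicQuotient] (χ : HeckeCharacter L) (_hχu : χ.IsUnitary) (_hχ : ∀ v, v ∉ S → ∀ w' : UnitaryGroup.PlacesOver L v, χ.IsUnramifiedAt w'.1)
      (_hIw : ∀ v, v ∉ S → ∀ x : UnitaryGroup.localPi L (IsCMField.complexConj L) (n + n) (hermD L e dV hdV dW hdW) v, ∃ p ∈ siegelDeltaLoc L e dV hdV dW hdW v, ∃ k ∈ UnitaryGroup.localInt L (IsCMField.complexConj L) (n + n) (hermD L e dV hdV dW hdW) v, x = p * k) (s₀ : ℂ) (_hs₀ : (N : ℝ) / 2 - 1 < s₀.re)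
      (Φ : HA L e dV hdV dW hdW → ℝ) (_hΦc : Continuous Φ) (_hΦpos : ∀ x, 0 < Φ x) (_hΦ : ∀ p x : HA L e dV hdV dW hdW, IsSiegelDelta L e dV hdV dW hdW p → Φ (p * x) = modDelta L e dV hdV dW hdW p * Φ x)
      (_hdecay : ∀ τ : ℝ, 2 * (N : ℝ) - 2 < τ → Integrable (fun x => Φ (iotaLeft L e dV hdV dW hdW (ιA (placesEmbed L H S x))) ^ τ) (νinf.prod (Measure.pi νS))) (φ₁ : (UnitaryGroup.adelicGroupData (Fp L) L (IsCMField.complexConj L) N H).automorphicQuotient → ℂ)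
      (_hφ₁c : Continuous φ₁) (_hφ₁ : φ₁ ≠ 0), ∃ (𝒦 : IwasawaDatum L e dV hdV dW hdW) (φ : HA L e dV hdV dW hdW → ℂ), 𝒦.IsStd ∧ (∀ k : HA L e dV hdV dW hdW, UnitaryGroup.archPart (Fp L) L (IsCMField.complexConj L) (n + n) (hermD L e dV hdV dW hdW) k = 1 →
      (∀ v, UnitaryGroup.evalPlace (Fp L) L (IsCMField.complexConj L) (n + n) (hermD L e dV hdV dW hdW) v (UnitaryGroup.finPart (Fp L) L (IsCMField.complexConj L) (n + n) (hermD L e dV hdV dW hdW) k) ∈ UnitaryGroup.localInt L (IsCMField.complexConj L) (n + n) (hermD L e dV hdV dW hdW) v) →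
      (∀ v ∈ S, UnitaryGroup.evalPlace (Fp L) L (IsCMField.complexConj L) (n + n) (hermD L e dV hdV dW hdW) v (UnitaryGroup.finPart (Fp L) L (IsCMField.complexConj L) (n + n) (hermD L e dV hdV dW hdW) k) = 1) → k ∈ 𝒦.K) ∧ IsSiegelDeltaSection L e dV hdV dW hdW χ s₀ φ ∧ IsKFinite 𝒦 φ ∧ Continuous φ ∧
      (∀ h k : HA L e dV hdV dW hdW, UnitaryGroup.archPart (Fp L) L (IsCMField.complexConj L) (n + n) (hermD L e dV hdV dW hdW) k = 1 → (∀ v, UnitaryGroup.evalPlace (Fp L) L (IsCMField.complexConj L) (n + n) (hermD L e dV hdV dW hdW) v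
      (UnitaryGroup.finPart (Fp L) L (IsCMField.complexConj L) (n + n) (hermD L e dV hdV dW hdW) k) ∈ UnitaryGroup.localInt L (IsCMField.complexConj L) (n + n) (hermD L e dV hdV dW hdW) v) → (∀ v ∈ S, UnitaryGroup.evalPlace (Fp L) L (IsCMField.complexConj L) (n + n) (hermD L e dV hdV dW hdW) v
      (UnitaryGroup.finPart (Fp L) L (IsCMField.complexConj L) (n + n) (hermD L e dV hdV dW hdW) k) = 1) → φ (h * k) = φ h) ∧ ∃ g₀ : (UnitaryGroup.adelicGroupData (Fp L) L (IsCMField.complexConj L) N H).Adelic, zetaS L e dV hdV dW hdW H S νinf νS μ ιA φ φ₁ (fun x => φ₁ (g₀ • x)) ≠ 0)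
    (L : Type) [Field L] [NumberField L] [IsCMField L] (ι : L →+* ℂ) (H : Matrix (Fin 2) (Fin 2) L) (dV : Fin 2 → L) (hdV : ∀ i, IsCMField.complexConj L (dV i) = dV i) (hdV0 : ∀ i, dV i ≠ 0)
    (t : L) (ht : t ≠ 0) (g : GL (Fin 2) L) (hg : formCongr ((IsCMField.complexConj L : L ≃ₐ[↥(maximalRealSubfield L)] L) : L →+* L) g (t • H) = Matrix.diagonal dV) (hpos : ∀ τ' : L →+* ℂ, InfinitePlace.mk τ' ≠ InfinitePlace.mk ι → ((Matrix.diagonal dV).map τ').PosDef) (h4L : 4 ≤ Module.finrank ℚ L)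
    (μ : Measure (adelicGroupData (↥(maximalRealSubfield L)) L (IsCMField.complexConj L) 2 H).automorphicQuotient) [(adelicGroupData (↥(maximalRealSubfield L)) L (IsCMField.complexConj L) 2 H).IsAutomorphicMeasure μ]
    {n' : ℕ} (e₁ : Fin 2 × Fin 1 ≃ Fin n') (lam : Literature.NumberTheory.Automorphic.IdeleClassGroup L →ₜ* Circle) (χ : Chi (↥(maximalRealSubfield L)) L (IsCMField.complexConj L))
    (ιA : (adelicGroupData (↥(maximalRealSubfield L)) L (IsCMField.complexConj L) 2 H).Adelic →* ↥(UnitaryGroup.adelic (↥(maximalRealSubfield L)) L (IsCMField.complexConj L) 2 (Matrix.diagonal dV)))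
    (hιA : ∀ k, ((ιA k : ↥(UnitaryGroup.adelic (↥(maximalRealSubfield L)) L (IsCMField.complexConj L) 2 (Matrix.diagonal dV))) : GL (Fin 2) (AdeleRing (𝓞 L) L)) = (toAdeleGL L g)⁻¹ * adelicVal (↥(maximalRealSubfield L)) L (IsCMField.complexConj L) 2 H k * toAdeleGL L g)
    [CompactSpace (adelicGroupData (↥(maximalRealSubfield L)) L (IsCMField.complexConj L) 2 H).automorphicQuotient] (P : DiscreteAutomorphicRep (adelicGroupData (↥(maximalRealSubfield L)) L (IsCMField.complexConj L) 2 H) μ) (Sf : Finset (HeightOneSpectrum (𝓞 ↥(maximalRealSubfield L))))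
    (hunr : ∀ v, v ∉ Sf → ∀ w' : UnitaryGroup.PlacesOver L v, (toHeckeCharacter L lam).IsUnramifiedAt w'.1 ∧ (toHeckeCharacter L lam⁻¹).IsUnramifiedAt w'.1 ∧ (HeckeCharacter.checkOfChi (complexConj_mul_complexConj' L) χ).IsUnramifiedAt w'.1)
    [∀ v : HeightOneSpectrum (𝓞 ↥(maximalRealSubfield L)), MeasurableSpace (UnitaryGroup.localPi L (IsCMField.complexConj L) 2 H v)] [∀ v : HeightOneSpectrum (𝓞 ↥(maximalRealSubfield L)), BorelSpace (UnitaryGroup.localPi L (IsCMField.complexConj L) 2 H v)]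
    (νv : ∀ v : HeightOneSpectrum (𝓞 ↥(maximalRealSubfield L)), Measure (UnitaryGroup.localPi L (IsCMField.complexConj L) 2 H v)) (hνv : ∀ v, (νv v).IsHaarMeasure) (hνK : ∀ v, v ∉ Sf → νv v (UnitaryGroup.localInt L (IsCMField.complexConj L) 2 H v : Set (UnitaryGroup.localPi L (IsCMField.complexConj L) 2 H v)) = 1)
    (w : P.space.toSubmodule) (wc : (adelicGroupData (↥(maximalRealSubfield L)) L (IsCMField.complexConj L) 2 H).automorphicQuotient → ℂ) (hwc : Continuous wc) (hwc0 : wc ≠ 0)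
    (hwae : (((w : (adelicGroupData (↥(maximalRealSubfield L)) L (IsCMField.complexConj L) 2 H).L2 μ)) : (adelicGroupData (↥(maximalRealSubfield L)) L (IsCMField.complexConj L) 2 H).automorphicQuotient → ℂ) =ᵐ[μ] wc)
    (hwK : ∀ k : (adelicGroupData (↥(maximalRealSubfield L)) L (IsCMField.complexConj L) 2 H).Adelic, UnitaryGroup.archPart (↥(maximalRealSubfield L)) L (IsCMField.complexConj L) 2 H k = 1 →
      (∀ v, UnitaryGroup.evalPlace (↥(maximalRealSubfield L)) L (IsCMField.complexConj L) 2 H v (UnitaryGroup.finPart (↥(maximalRealSubfield L)) L (IsCMField.complexConj L) 2 H k) ∈ UnitaryGroup.localInt L (IsCMField.complexConj L) 2 H v) →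
      (∀ v ∈ Sf, UnitaryGroup.evalPlace (↥(maximalRealSubfield L)) L (IsCMField.complexConj L) 2 H v (UnitaryGroup.finPart (↥(maximalRealSubfield L)) L (IsCMField.complexConj L) 2 H k) = 1) → P.space.toContRep k w = w) (hloc : ∀ v : HeightOneSpectrum (𝓞 ↥(maximalRealSubfield L)), v ∉ Sf →
      (∀ (s : ℂ) (k : UnitaryGroup.localPi L (IsCMField.complexConj L) 2 H v), k ∈ UnitaryGroup.localInt L (IsCMField.complexConj L) 2 H v → LambdaLoc L e₁ dV hdV (fun _ : Fin 1 => (1 : L)) (fun _ => map_one _) v (toHeckeCharacter L lam⁻¹) s (iotaLeftLocPi L e₁ dV hdV (fun _ : Fin 1 => (1 : L)) (fun _ => map_one _) v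
            (localCongr L (IsCMField.complexConj L) g⁻¹ (inv_ne_zero ht) (formCongr_inv_diagonal L H dV t ht g hg) v k)) = 1) ∧ (∀ x : UnitaryGroup.localPi L (IsCMField.complexConj L) (n' + n') (hermD L e₁ dV hdV (fun _ : Fin 1 => (1 : L)) (fun _ => map_one _)) v,
        ∃ p ∈ siegelDeltaLoc L e₁ dV hdV (fun _ : Fin 1 => (1 : L)) (fun _ => map_one _) v, ∃ k ∈ UnitaryGroup.localInt L (IsCMField.complexConj L) (n' + n') (hermD L e₁ dV hdV (fun _ : Fin 1 => (1 : L)) (fun _ => map_one _)) v, x = p * k) ∧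
      (∀ s : ℂ, 1 ≤ s.re → Integrable (fun y => LambdaLoc L e₁ dV hdV (fun _ : Fin 1 => (1 : L)) (fun _ => map_one _) v (toHeckeCharacter L lam⁻¹) s (iotaLeftLocPi L e₁ dV hdV (fun _ : Fin 1 => (1 : L)) (fun _ => map_one _) v
            (localCongr L (IsCMField.complexConj L) g⁻¹ (inv_ne_zero ht) (formCongr_inv_diagonal L H dV t ht g hg) v y))) (νv v) ∧ ∫ y, ‖LambdaLoc L e₁ dV hdV (fun _ : Fin 1 => (1 : L)) (fun _ => map_one _) v (toHeckeCharacter L lam⁻¹) s (iotaLeftLocPi L e₁ dV hdV (fun _ : Fin 1 => (1 : L)) (fun _ => map_one _) v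
            (localCongr L (IsCMField.complexConj L) g⁻¹ (inv_ne_zero ht) (formCongr_inv_diagonal L H dV t ht g hg) v y))‖ ∂(νv v) ≤ 1 + max (Classical.choose (exists_integral_norm_lambdaLoc_le 1 one_pos))
                (Classical.choose (exists_integral_norm_lambdaLoc_le_inert 1 one_pos)) * (v.residueCard : ℝ) ^ (-s.re)) ∧ ∃ Θ₁ Θ₂ : ℂ, ‖Θ₁‖ ≤ 1 ∧ ‖Θ₂‖ ≤ 1 ∧ ∀ (φ₂L : (adelicGroupData (↥(maximalRealSubfield L)) L (IsCMField.complexConj L) 2 H).L2 μ)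
          (φ₂ : (adelicGroupData (↥(maximalRealSubfield L)) L (IsCMField.complexConj L) 2 H).automorphicQuotient → ℂ), (((φ₂L : (adelicGroupData (↥(maximalRealSubfield L)) L (IsCMField.complexConj L) 2 H).L2 μ) :
            (adelicGroupData (↥(maximalRealSubfield L)) L (IsCMField.complexConj L) 2 H).automorphicQuotient → ℂ) =ᵐ[μ] φ₂) → ∀ s : ℂ, 0 < s.re → ∃ c₀ : ℂ, (∀ tt : (adelicGroupData (↥(maximalRealSubfield L)) L (IsCMField.complexConj L) 2 H).Adelic, localZeta (νv v)
                  (fun y => LambdaLoc L e₁ dV hdV (fun _ : Fin 1 => (1 : L)) (fun _ => map_one _) v (toHeckeCharacter L lam⁻¹) s (iotaLeftLocPi L e₁ dV hdV (fun _ : Fin 1 => (1 : L)) (fun _ => map_one _) v (localCongr L (IsCMField.complexConj L) g⁻¹ (inv_ne_zero ht) (formCongr_inv_diagonal L H dV t ht g hg) v y)))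
                  (fun y => quotMatrixCoeff (adelicGroupData (↥(maximalRealSubfield L)) L (IsCMField.complexConj L) 2 H) μ wc φ₂ (tt * UnitaryGroup.inclPlaceAdelic (↥(maximalRealSubfield L)) L (IsCMField.complexConj L) 2 H v y)) =
                c₀ * quotMatrixCoeff (adelicGroupData (↥(maximalRealSubfield L)) L (IsCMField.complexConj L) 2 H) μ wc φ₂ tt) ∧ c₀ * ∏ᶠ w' : UnitaryGroup.PlacesOver L v, ((1 - (w'.1.residueCard : ℂ) ^ (-(s + 1 / 2))) * (1 - ((muAlg L lam)⁻¹ * (HeckeCharacter.galConj (IsCMField.complexConj L) (muAlg L lam) *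
                      HeckeCharacter.checkOfChi (complexConj_mul_complexConj' L) χ)).valueAtUniformizer w'.1 * (w'.1.residueCard : ℂ) ^ (-(s + 1 / 2)))) = (1 - Θ₁ * (v.residueCard : ℂ) ^ (-(2 * s + 2))) * (1 - Θ₂ * (v.residueCard : ℂ) ^ (-(2 * s + 1)))) :
    ∃ (𝒦 : Literature.NumberTheory.K2Lit.SiegelDoubled.IwasawaDatum L e₁ dV hdV (fun _ : Fin 1 => (1 : L)) (fun _ => map_one _)) (f : ℂ → ↥(HA L e₁ dV hdV (fun _ : Fin 1 => (1 : L)) (fun _ => map_one _)) → ℂ), 𝒦.IsStd ∧ Literature.NumberTheory.K2Lit.SiegelDoubled.IsStandardSectionFamily 𝒦 (toHeckeCharacter L lam⁻¹) f ∧ (∀ s, Continuous (f s)) ∧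
    ∃ (w : (adelicGroupData (↥(maximalRealSubfield L)) L (IsCMField.complexConj L) 2 H).L2 μ) (_ : w ∈ P.space.toSubmodule) (w' : (adelicGroupData (↥(maximalRealSubfield L)) L (IsCMField.complexConj L) 2 H).L2 μ) (_ : w' ∈ P.space.toSubmodule)
      (ψ : HeckeCharacter L) (_ : ψ.IsUnitary) (_ : ∀ t : ℝ≥0ˣ, ψ (posRealIdele L t) = 1) (S : Set (HeightOneSpectrum (𝓞 L))) (_ : S.Finite) (_ : ∀ v ∉ S, ψ.IsUnramifiedAt v) (r : ℂ → ℂ) (U : Set ℂ) (s₁ : ℝ) (_ : IsOpen U) (_ : Convex ℝ U) (_ : (1 / 2 : ℂ) ∈ U) (_ : (1 : ℝ) ≤ s₁)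
      (_ : {s : ℂ | s₁ < s.re} ⊆ U) (_ : DifferentiableOn ℂ r U) (_ : r (1 / 2) ≠ 0), ∀ s : ℂ, s₁ < s.re → Literature.NumberTheory.K2Lit.SiegelDoubled.doublingPairing (adelicGroupData (↥(maximalRealSubfield L)) L (IsCMField.complexConj L) 2 H) μ
          (Literature.NumberTheory.K2Lit.SiegelDoubled.toQuotFun₂ (adelicGroupData (↥(maximalRealSubfield L)) L (IsCMField.complexConj L) 2 H) (fun g => Literature.NumberTheory.K2Lit.SiegelDoubled.eisensteinSeriesDelta L e₁ dV hdV (fun _ : Fin 1 => (1 : L)) (fun _ => map_one _) (f s)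
              (Literature.NumberTheory.K2Lit.SiegelDoubled.iotaV L e₁ dV hdV (fun _ : Fin 1 => (1 : L)) (fun _ => map_one _) (ιA g.1, ιA g.2)))) (fun α => w α) (fun α => Literature.NumberTheory.K2Lit.SiegelDoubled.siegelDeltaCharacter L e₁ dV hdV (fun _ : Fin 1 => (1 : L)) (fun _ => map_one _) (toHeckeCharacter L lam⁻¹) s
            (Literature.NumberTheory.K2Lit.SiegelDoubled.iotaV L e₁ dV hdV (fun _ : Fin 1 => (1 : L)) (fun _ => map_one _)
              (ιA ((Quotient.out (α : (adelicGroupData (↥(maximalRealSubfield L)) L (IsCMField.complexConj L) 2 H).Adelic ⧸ (adelicGroupData (↥(maximalRealSubfield L)) L (IsCMField.complexConj L) 2 H).quotientSubgroup)) : (adelicGroupData (↥(maximalRealSubfield L)) L (IsCMField.complexConj L) 2 H).Adelic)⁻¹,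
               ιA ((Quotient.out (α : (adelicGroupData (↥(maximalRealSubfield L)) L (IsCMField.complexConj L) 2 H).Adelic ⧸ (adelicGroupData (↥(maximalRealSubfield L)) L (IsCMField.complexConj L) 2 H).quotientSubgroup)) : (adelicGroupData (↥(maximalRealSubfield L)) L (IsCMField.complexConj L) 2 H).Adelic)⁻¹)) * w' α) =
          r s * ∏' v : {v : HeightOneSpectrum (𝓞 L) // v ∉ S}, ((1 - (((v.1.residueCard : ℂ) ^ (-(s + 1 / 2)))))⁻¹ * (1 - ψ.valueAtUniformizer v.1 * ((v.1.residueCard : ℂ) ^ (-(s + 1 / 2))))⁻¹) := by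
  classical
  haveI : Algebra.IsQuadraticExtension (↥(maximalRealSubfield L)) L := IsCMField.isQuadraticExtension L
  haveI : ∀ v, (νv v).IsHaarMeasure := hνv
  -- Borel structures on `U(H)(𝔸)`, `U(H)_∞` and `U(V)(𝔸)`
  letI iH : MeasurableSpace (adelicGroupData (↥(maximalRealSubfield L)) L (IsCMField.complexConj L) 2 H).Adelic := borel _
  haveI iHb : BorelSpace (adelicGroupData (↥(maximalRealSubfield L)) L (IsCMField.complexConj L) 2 H).Adelic := ⟨rfl⟩
  letI : MeasurableSpace (UnitaryGroup.arch (↥(maximalRealSubfield L)) L (IsCMField.complexConj L) 2 H) := borel _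
  haveI : BorelSpace (UnitaryGroup.arch (↥(maximalRealSubfield L)) L (IsCMField.complexConj L) 2 H) := ⟨rfl⟩
  letI iV : MeasurableSpace (UnitaryGroup.adelic (↥(maximalRealSubfield L)) L (IsCMField.complexConj L) 2 (Matrix.diagonal dV)) := borel _
  haveI iVb : BorelSpace (UnitaryGroup.adelic (↥(maximalRealSubfield L)) L (IsCMField.complexConj L) 2 (Matrix.diagonal dV)) := ⟨rfl⟩
  -- `n' = 2`
  have hn' : n' = 2 := by
    have hc := Fintype.card_congr e₁
    simp only [Fintype.card_prod, Fintype.card_fin] at hc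
    omega
  subst hn'
  -- (an) anisotropy of `H`, ★ #13 with `L²` slots, ★ #29s's archimedean factor
  have hanis := K2LiuDoublingZetaGL1Anisotropic.anisotropic_of_seam L ι H dV t g hg hpos h4L
  obtain ⟨ν, hν, h13⟩ := K2LiuDoublingZetaGL1Unfold.doublingUnfold_ae_twist L e₁ H dV hdV (fun _ : Fin 1 => (1 : L)) (fun _ => map_one _) hdV0 (fun _ => one_ne_zero) t ht g hg
    hanis μ ιA hιA
  haveI := hν
  obtain ⟨νinf, hνinf, h29⟩ := K2LiuDoublingPartialEuler.doublingPartialEuler L e₁ dV hdV (fun _ : Fin 1 => (1 : L)) (fun _ => map_one _) H Sf ν νv hνK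
  haveI := hνinf
  -- `χ_D = λ̃⁻¹`, `Ψ`
  have hχu : (toHeckeCharacter L lam⁻¹).IsUnitary := isUnitary_toHeckeCharacter L lam⁻¹
  have hχS : ∀ v, v ∉ Sf → ∀ w' : UnitaryGroup.PlacesOver L v, (toHeckeCharacter L lam⁻¹).IsUnramifiedAt w'.1 :=
    fun v hv w' => (hunr v hv w').2.1
  have hΨu := K2LiuDoublingZetaGL1Character.isUnitary_character L lam χ
  -- (Iw) off `Sf`
  have hIw : ∀ v, v ∉ Sf → ∀ x : UnitaryGroup.localPi L (IsCMField.complexConj L) (2 + 2) (hermD L e₁ dV hdV (fun _ : Fin 1 => (1 : L)) (fun _ => map_one _)) v, ∃ p ∈ siegelDeltaLoc L e₁ dV hdV (fun _ : Fin 1 => (1 : L)) (fun _ => map_one _) v,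
        ∃ k ∈ UnitaryGroup.localInt L (IsCMField.complexConj L) (2 + 2) (hermD L e₁ dV hdV (fun _ : Fin 1 => (1 : L)) (fun _ => map_one _)) v, x = p * k :=
    fun v hv => (hloc v hv).2.1
  -- a height of type `(P_Δ, modDelta)` and its decay along the seam (#32dR)
  obtain ⟨Φ, hΦc, hΦpos, hΦ⟩ := K2LiuSiegelDeltaHeightExists.siegelDeltaHeightExists L e₁ dV hdV hdV0 (fun _ : Fin 1 => (1 : L)) (fun _ => map_one _) (fun _ => one_ne_zero)
  have hdecay : ∀ τ : ℝ, 2 * ((2 : ℕ) : ℝ) - 2 < τ → Integrable (fun x => Φ (iotaLeft L e₁ dV hdV (fun _ : Fin 1 => (1 : L)) (fun _ => map_one _) (ιA (placesEmbed L H Sf x))) ^ τ) (νinf.prod (Measure.pi (fun v : Sf => νv v.1))) := by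
    intro τ hτ
    exact h32dR L e₁ dV hdV hdV0 ι hpos (fun _ : Fin 1 => (1 : L)) (fun _ => map_one _) (fun _ => one_ne_zero) H t ht g hg ιA hιA Sf νinf (fun v : Sf => νv v.1) Φ hΦc hΦpos hΦ τ
      (by norm_num at hτ ⊢; exact hτ)
  -- #33s: the standard datum, the section and the non-vanishing translate
  have hre : ((2 : ℕ) : ℝ) / 2 - 1 < (1 / 2 : ℂ).re := by norm_num [Complex.div_re]
  obtain ⟨𝒦, φ, h𝒦, hKS, hsec, hKf, hφc, hRφ, g₀, hZ⟩ := h33s L e₁ dV hdV hdV0 (fun _ : Fin 1 => (1 : L)) (fun _ => map_one _) (fun _ => one_ne_zero) H t ht g hg ιA hιA Sf νinf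
    (fun v : Sf => νv v.1) μ (toHeckeCharacter L lam⁻¹) hχu hχS hIw (1 / 2) hre Φ hΦc hΦpos hΦ hdecay wc hwc hwc0
  -- the standard family `f := stdExtension 𝒦 ½ φ`
  have hKu : 𝒦.IsDeltaUnimodular := K2LiuIwasawaDeltaUnimodular.IwasawaDatum.modDelta_eq_one_of_mem L e₁ dV hdV hdV0 (fun _ : Fin 1 => (1 : L)) (fun _ => map_one _)
    (fun _ => one_ne_zero) 𝒦
  have hfam : IsStandardSectionFamily 𝒦 (toHeckeCharacter L lam⁻¹) (stdExtension 𝒦 (1 / 2) φ) :=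
    isStandardSectionFamily_stdExtension hKu hsec hKf
  obtain ⟨hΦ𝒦pos, hΦ𝒦c⟩ := K2LiuIwasawaHeightContinuous.iwasawaHeightContinuous L e₁ dV hdV hdV0 (fun _ : Fin 1 => (1 : L)) (fun _ => map_one _) (fun _ => one_ne_zero) 𝒦
  have hfc : ∀ s : ℂ, Continuous (stdExtension 𝒦 (1 / 2) φ s) := fun s => by
    show Continuous fun h => ((modDelta L e₁ dV hdV (fun _ : Fin 1 => (1 : L)) (fun _ => map_one _) (𝒦.pPart h) : ℝ) : ℂ) ^ (2 * (s - 1 / 2)) * φ h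
    exact ((Complex.continuous_ofReal.comp hΦ𝒦c).cpow continuous_const fun h => Complex.ofReal_mem_slitPlane.2 (hΦ𝒦pos h)).mul hφc
  -- right-`K^S_H`-invariance at `s₀ = ½` and factorisation off `Sf` (★ #31s)
  have hR : ∀ h k : HA L e₁ dV hdV (fun _ : Fin 1 => (1 : L)) (fun _ => map_one _), UnitaryGroup.archPart (↥(maximalRealSubfield L)) L (IsCMField.complexConj L) (2 + 2) (hermD L e₁ dV hdV (fun _ : Fin 1 => (1 : L)) (fun _ => map_one _)) k = 1 →
      (∀ v, UnitaryGroup.evalPlace (↥(maximalRealSubfield L)) L (IsCMField.complexConj L) (2 + 2) (hermD L e₁ dV hdV (fun _ : Fin 1 => (1 : L)) (fun _ => map_one _)) v (UnitaryGroup.finPart (↥(maximalRealSubfield L)) L (IsCMField.complexConj L) (2 + 2) (hermD L e₁ dV hdV (fun _ : Fin 1 => (1 : L)) (fun _ => map_one _)) k) ∈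
        UnitaryGroup.localInt L (IsCMField.complexConj L) (2 + 2) (hermD L e₁ dV hdV (fun _ : Fin 1 => (1 : L)) (fun _ => map_one _)) v) →
      (∀ v ∈ Sf, UnitaryGroup.evalPlace (↥(maximalRealSubfield L)) L (IsCMField.complexConj L) (2 + 2) (hermD L e₁ dV hdV (fun _ : Fin 1 => (1 : L)) (fun _ => map_one _)) v
          (UnitaryGroup.finPart (↥(maximalRealSubfield L)) L (IsCMField.complexConj L) (2 + 2) (hermD L e₁ dV hdV (fun _ : Fin 1 => (1 : L)) (fun _ => map_one _)) k) = 1) →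
      stdExtension 𝒦 (1 / 2) φ (1 / 2) (h * k) = stdExtension 𝒦 (1 / 2) φ (1 / 2) h := by
    intro h k h1 h2 h3
    rw [stdExtension_self]
    exact hRφ h k h1 h2 h3
  obtain ⟨-, hfac⟩ := K2LiuStdFamilyFactorisable.stdFamilyFactorisable L e₁ dV hdV hdV0 (fun _ : Fin 1 => (1 : L)) (fun _ => map_one _) (fun _ => one_ne_zero) Sf
    (toHeckeCharacter L lam⁻¹) hχS hIw 𝒦 _ hfam hKS (1 / 2) hR
  -- the translated slot `w' = P(g₀⁻¹) w =ᵐ wc(g₀ • ·)`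
  have hw'ae := K2LiuDoublingZetaGL1Level.coe_toContRep_inv_ae_eq P w hwae g₀
  have hwc'c := K2LiuDoublingZetaGL1Level.continuous_comp_smul hwc g₀
  -- `ιA` as an isomorphism of topological groups; ★ #14a's abscissa
  obtain ⟨Φi, hΦi⟩ : ∃ Φ' : (adelicGroupData (↥(maximalRealSubfield L)) L (IsCMField.complexConj L) 2 H).Adelic ≃ₜ* ↥(UnitaryGroup.adelic (↥(maximalRealSubfield L)) L (IsCMField.complexConj L) 2 (Matrix.diagonal dV)), ∀ x, Φ' x = ιA x := by
    obtain ⟨Φ₀, -, hΦ₀⟩ := K2LiuDoublingUnfoldBridge.exists_continuousMulEquiv_eq_iotaA L H dV t ht g hg ιA hιA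
    exact ⟨Φ₀, hΦ₀⟩
  have hιAc : Continuous fun x : (adelicGroupData (↥(maximalRealSubfield L)) L (IsCMField.complexConj L) 2 H).Adelic => (ιA x : ↥(UnitaryGroup.adelic (↥(maximalRealSubfield L)) L (IsCMField.complexConj L) 2 (Matrix.diagonal dV))) := by
    have hfun : (fun x : (adelicGroupData (↥(maximalRealSubfield L)) L (IsCMField.complexConj L) 2 H).Adelic => (ιA x : ↥(UnitaryGroup.adelic (↥(maximalRealSubfield L)) L (IsCMField.complexConj L) 2 (Matrix.diagonal dV)))) = fun x => Φi x :=
      funext fun x => (hΦi x).symm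
    rw [hfun]
    exact Φi.continuous
  obtain ⟨σ₀, h14⟩ := K2LiuDoublingSectionIntegrable.doublingSectionIntegrable L e₁ dV hdV hdV0 (fun _ : Fin 1 => (1 : L)) (fun _ => map_one _) (fun _ => one_ne_zero)
    (toHeckeCharacter L lam⁻¹)
  -- the place constants `Θ₁, Θ₂` and the closed forms `c_v(s)`
  have hΘ : ∀ v, v ∉ Sf → ∃ Θ₁ Θ₂ : ℂ, ‖Θ₁‖ ≤ 1 ∧ ‖Θ₂‖ ≤ 1 ∧ ∀ (φ₂L : (adelicGroupData (↥(maximalRealSubfield L)) L (IsCMField.complexConj L) 2 H).L2 μ) (φ₂ : (adelicGroupData (↥(maximalRealSubfield L)) L (IsCMField.complexConj L) 2 H).automorphicQuotient → ℂ),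
        (((φ₂L : (adelicGroupData (↥(maximalRealSubfield L)) L (IsCMField.complexConj L) 2 H).L2 μ)) : (adelicGroupData (↥(maximalRealSubfield L)) L (IsCMField.complexConj L) 2 H).automorphicQuotient → ℂ) =ᵐ[μ] φ₂ → ∀ s : ℂ, 0 < s.re → ∃ c₀ : ℂ,
          (∀ tt : (adelicGroupData (↥(maximalRealSubfield L)) L (IsCMField.complexConj L) 2 H).Adelic,
            localZeta (νv v) (fun y => LambdaLoc L e₁ dV hdV (fun _ : Fin 1 => (1 : L)) (fun _ => map_one _) v (toHeckeCharacter L lam⁻¹) s (iotaLeftLocPi L e₁ dV hdV (fun _ : Fin 1 => (1 : L)) (fun _ => map_one _) v ((localCongr L (IsCMField.complexConj L) g⁻¹ (inv_ne_zero ht) (formCongr_inv_diagonal L H dV t ht g hg) v) y)))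
                (fun y => quotMatrixCoeff (adelicGroupData (↥(maximalRealSubfield L)) L (IsCMField.complexConj L) 2 H) μ wc φ₂ (tt * UnitaryGroup.inclPlaceAdelic (↥(maximalRealSubfield L)) L (IsCMField.complexConj L) 2 H v y)) =
              c₀ * quotMatrixCoeff (adelicGroupData (↥(maximalRealSubfield L)) L (IsCMField.complexConj L) 2 H) μ wc φ₂ tt) ∧
          c₀ * ∏ᶠ w' : UnitaryGroup.PlacesOver L v, ((1 - (w'.1.residueCard : ℂ) ^ (-(s + 1 / 2))) * (1 - ((muAlg L lam)⁻¹ * (HeckeCharacter.galConj (IsCMField.complexConj L) (muAlg L lam) *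
        HeckeCharacter.checkOfChi (complexConj_mul_complexConj' L) χ)).valueAtUniformizer w'.1 * (w'.1.residueCard : ℂ) ^ (-(s + 1 / 2)))) = (1 - Θ₁ * (v.residueCard : ℂ) ^ (-(2 * s + 2))) * (1 - Θ₂ * (v.residueCard : ℂ) ^ (-(2 * s + 1))) :=
    fun v hv => (hloc v hv).2.2.2
  choose Θ₁ Θ₂ hΘ₁ hΘ₂ hEH using hΘ
  obtain ⟨θ₁, hθ₁, hθ₁b⟩ : ∃ θ₁ : HeightOneSpectrum (𝓞 ↥(maximalRealSubfield L)) → ℂ, (∀ v (hv : v ∉ Sf), θ₁ v = Θ₁ v hv) ∧ ∀ v, ‖θ₁ v‖ ≤ 1 := by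
    refine ⟨fun v => if hv : v ∈ Sf then 0 else Θ₁ v hv, fun v hv => dif_neg hv, fun v => ?_⟩
    by_cases hv : v ∈ Sf
    · dsimp only; rw [dif_pos hv, norm_zero]; exact zero_le_one
    · dsimp only; rw [dif_neg hv]; exact hΘ₁ v hv
  obtain ⟨θ₂, hθ₂, hθ₂b⟩ : ∃ θ₂ : HeightOneSpectrum (𝓞 ↥(maximalRealSubfield L)) → ℂ, (∀ v (hv : v ∉ Sf), θ₂ v = Θ₂ v hv) ∧ ∀ v, ‖θ₂ v‖ ≤ 1 := by
    refine ⟨fun v => if hv : v ∈ Sf then 0 else Θ₂ v hv, fun v hv => dif_neg hv, fun v => ?_⟩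
    by_cases hv : v ∈ Sf
    · dsimp only; rw [dif_pos hv, norm_zero]; exact zero_le_one
    · dsimp only; rw [dif_neg hv]; exact hΘ₂ v hv
  -- the denominators of the GL₁ shape do not vanish on `Re s > 0`
  have hDen : ∀ (v : HeightOneSpectrum (𝓞 ↥(maximalRealSubfield L))) (s : ℂ), 0 < s.re → (∏ᶠ w' : UnitaryGroup.PlacesOver L v, ((1 - (w'.1.residueCard : ℂ) ^ (-(s + 1 / 2))) * (1 - ((muAlg L lam)⁻¹ * (HeckeCharacter.galConj (IsCMField.complexConj L) (muAlg L lam) *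
        HeckeCharacter.checkOfChi (complexConj_mul_complexConj' L) χ)).valueAtUniformizer w'.1 * (w'.1.residueCard : ℂ) ^ (-(s + 1 / 2))))) ≠ 0 := by
    intro v s hs
    have hs' : 0 < (s + 1 / 2 : ℂ).re := by rw [K2LiuThetaTypeDoublingEulerFactorGL1.re_add_half]; linarith
    rw [finprod_eq_prod_of_fintype, Finset.prod_ne_zero_iff]
    intro w' _
    exact mul_ne_zero (K2LiuThetaTypeDoublingEulerFactorGL1.one_sub_cpow_neg_ne_zero w'.1 hs')
      (one_sub_valueAtUniformizer_mul_cpow_ne_zero hΨu w'.1 hs')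
  obtain ⟨cfun, hcfun⟩ : ∃ cfun : HeightOneSpectrum (𝓞 ↥(maximalRealSubfield L)) → ℂ → ℂ, ∀ v s, cfun v s = (1 - θ₁ v * (v.residueCard : ℂ) ^ (-(2 * s + 2))) * (1 - θ₂ v * (v.residueCard : ℂ) ^ (-(2 * s + 1))) / ∏ᶠ w' : UnitaryGroup.PlacesOver L v, ((1 - (w'.1.residueCard : ℂ) ^ (-(s + 1 / 2))) *
            (1 - ((muAlg L lam)⁻¹ * (HeckeCharacter.galConj (IsCMField.complexConj L) (muAlg L lam) *
        HeckeCharacter.checkOfChi (complexConj_mul_complexConj' L) χ)).valueAtUniformizer w'.1 * (w'.1.residueCard : ℂ) ^ (-(s + 1 / 2)))) := ⟨_, fun _ _ => rfl⟩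
  -- ★ #30s: the GL₁ shape of `∏' c_v`
  have hc : ∀ v, v ∉ Sf → ∀ s : ℂ, 0 < s.re → cfun v s * ∏ᶠ w' : UnitaryGroup.PlacesOver L v, ((1 - (w'.1.residueCard : ℂ) ^ (-(s + 1 / 2))) * (1 - ((muAlg L lam)⁻¹ * (HeckeCharacter.galConj (IsCMField.complexConj L) (muAlg L lam) *
        HeckeCharacter.checkOfChi (complexConj_mul_complexConj' L) χ)).valueAtUniformizer w'.1 * (w'.1.residueCard : ℂ) ^ (-(s + 1 / 2)))) =
        (1 - θ₁ v * (v.residueCard : ℂ) ^ (-(2 * s + 2))) * (1 - θ₂ v * (v.residueCard : ℂ) ^ (-(2 * s + 1))) := by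
    intro v _ s hs
    rw [hcfun]
    exact div_mul_cancel₀ _ (hDen v s hs)
  obtain ⟨hBdiff, hBne, h30⟩ := K2LiuThetaTypeDoublingEulerFactorGL1.thetaTypeDoublingEulerFactorGL1 L Sf ((muAlg L lam)⁻¹ * (HeckeCharacter.galConj (IsCMField.complexConj L) (muAlg L lam) * HeckeCharacter.checkOfChi (complexConj_mul_complexConj' L) χ)) hΨu θ₁ θ₂ hθ₁b hθ₂b cfun hc
  -- the universal `L¹`-constant is non-negative
  have hC0 : 0 ≤ max (Classical.choose (exists_integral_norm_lambdaLoc_le 1 one_pos)) (Classical.choose (exists_integral_norm_lambdaLoc_le_inert 1 one_pos)) :=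
    le_trans (Classical.choose_spec (exists_integral_norm_lambdaLoc_le 1 one_pos)).1 (le_max_left _ _)
  -- ### THE IDENTITY `Z(s) = (∏' c_v(s)) · Z_S(s)` for `Re s > max 1 σ₀`
  have h29' : ∀ s : ℂ, max 1 σ₀ < s.re → doublingPairing (adelicGroupData (↥(maximalRealSubfield L)) L (IsCMField.complexConj L) 2 H) μ
          (toQuotFun₂ (adelicGroupData (↥(maximalRealSubfield L)) L (IsCMField.complexConj L) 2 H) (eisensteinPullback L e₁ dV hdV (fun _ : Fin 1 => (1 : L)) (fun _ => map_one _) (adelicGroupData (↥(maximalRealSubfield L)) L (IsCMField.complexConj L) 2 H) ιA (stdExtension 𝒦 (1 / 2) φ s)))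
          (fun α => ((w : (adelicGroupData (↥(maximalRealSubfield L)) L (IsCMField.complexConj L) 2 H).L2 μ) : (adelicGroupData (↥(maximalRealSubfield L)) L (IsCMField.complexConj L) 2 H).automorphicQuotient → ℂ) α)
          (fun α => siegelDeltaCharacter L e₁ dV hdV (fun _ : Fin 1 => (1 : L)) (fun _ => map_one _) (toHeckeCharacter L lam⁻¹) s
            (iotaV L e₁ dV hdV (fun _ : Fin 1 => (1 : L)) (fun _ => map_one _)
              (ιA ((Quotient.out (α : (adelicGroupData (↥(maximalRealSubfield L)) L (IsCMField.complexConj L) 2 H).Adelic ⧸ (adelicGroupData (↥(maximalRealSubfield L)) L (IsCMField.complexConj L) 2 H).quotientSubgroup)) : (adelicGroupData (↥(maximalRealSubfield L)) L (IsCMField.complexConj L) 2 H).Adelic)⁻¹,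
               ιA ((Quotient.out (α : (adelicGroupData (↥(maximalRealSubfield L)) L (IsCMField.complexConj L) 2 H).Adelic ⧸ (adelicGroupData (↥(maximalRealSubfield L)) L (IsCMField.complexConj L) 2 H).quotientSubgroup)) : (adelicGroupData (↥(maximalRealSubfield L)) L (IsCMField.complexConj L) 2 H).Adelic)⁻¹)) *
            ((((P.space.toContRep g₀⁻¹ w : P.space.toSubmodule)) : (adelicGroupData (↥(maximalRealSubfield L)) L (IsCMField.complexConj L) 2 H).L2 μ) : (adelicGroupData (↥(maximalRealSubfield L)) L (IsCMField.complexConj L) 2 H).automorphicQuotient → ℂ) α) =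
        (∏' v : {v : HeightOneSpectrum (𝓞 ↥(maximalRealSubfield L)) // v ∉ Sf}, cfun v.1 s) *
          zetaS L e₁ dV hdV (fun _ : Fin 1 => (1 : L)) (fun _ => map_one _) H Sf νinf (fun v : Sf => νv v.1) μ ιA (stdExtension 𝒦 (1 / 2) φ s) wc (fun x => wc (g₀ • x)) := by
    intro s hs
    have hs1 : 1 < s.re := lt_of_le_of_lt (le_max_left _ _) hs
    have hsσ : σ₀ < s.re := lt_of_le_of_lt (le_max_right _ _) hs
    have hs0 : 0 < s.re := lt_trans zero_lt_one hs1
    have hsn : ((2 : ℕ) : ℝ) / 2 < s.re := by norm_num; exact hs1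
    -- the section at `s`: Siegel law, continuity, summability (★ #9), majorant (★ O1)
    have hsecs := isSiegelDeltaSection_stdExtension hKu hsec s
    have hsum := K2LiuSiegelEisensteinDoubledSummable.siegelEisensteinDoubledSummable L e₁ dV hdV hdV0 (fun _ : Fin 1 => (1 : L)) (fun _ => map_one _) (fun _ => one_ne_zero)
      (toHeckeCharacter L lam⁻¹) hχu s hsn _ hsecs (hfc s)
    have hmaj := K2LiuDoublingZetaGL1Majorant.integrable_majorant_mul L e₁ H dV hdV (fun _ : Fin 1 => (1 : L)) (fun _ => map_one _) hdV0 (fun _ => one_ne_zero) t ht g hg μ ιA hιA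
      (toHeckeCharacter L lam⁻¹) hχu s hsn _ hsecs (hfc s) wc (fun x => wc (g₀ • x)) hwc hwc'c
    -- ★ #13
    obtain ⟨-, hunf⟩ := h13 (toHeckeCharacter L lam⁻¹) hχu s _ hsecs (hfc s) hsum
      (fun α => ((w : (adelicGroupData (↥(maximalRealSubfield L)) L (IsCMField.complexConj L) 2 H).L2 μ) : (adelicGroupData (↥(maximalRealSubfield L)) L (IsCMField.complexConj L) 2 H).automorphicQuotient → ℂ) α)
      (fun α => ((((P.space.toContRep g₀⁻¹ w : P.space.toSubmodule)) : (adelicGroupData (↥(maximalRealSubfield L)) L (IsCMField.complexConj L) 2 H).L2 μ) : (adelicGroupData (↥(maximalRealSubfield L)) L (IsCMField.complexConj L) 2 H).automorphicQuotient → ℂ) α)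
      wc (fun x => wc (g₀ • x)) hwae hw'ae hwc hwc'c hmaj
    rw [hunf]
    -- ★ #29s at `s`: (F)
    obtain ⟨FS, hF⟩ := K2LiuDoublingZetaGL1Factor.factorizable_pullback L e₁ H dV hdV (fun _ : Fin 1 => (1 : L)) (fun _ => map_one _) t ht g hg ιA hιA Sf (toHeckeCharacter L lam⁻¹) _ _ hfac s
    -- (I)
    have hfcs : Continuous fun x : (adelicGroupData (↥(maximalRealSubfield L)) L (IsCMField.complexConj L) 2 H).Adelic => stdExtension 𝒦 (1 / 2) φ s (iotaLeft L e₁ dV hdV (fun _ : Fin 1 => (1 : L)) (fun _ => map_one _) (ιA x)) :=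
      (hfc s).comp ((continuous_iotaLeft L e₁ dV hdV (fun _ : Fin 1 => (1 : L)) (fun _ => map_one _)).comp hιAc)
    have hfis : Integrable (fun x : (adelicGroupData (↥(maximalRealSubfield L)) L (IsCMField.complexConj L) 2 H).Adelic => stdExtension 𝒦 (1 / 2) φ s (iotaLeft L e₁ dV hdV (fun _ : Fin 1 => (1 : L)) (fun _ => map_one _) (ιA x))) ν := by
      have hint := h14 s hsσ _ hsecs (hfc s) (Measure.map Φi ν)
      set Φim := Φi.toHomeomorph.toMeasurableEquiv with hΦim
      have hcoe : (Φim : (adelicGroupData (↥(maximalRealSubfield L)) L (IsCMField.complexConj L) 2 H).Adelic → ↥(UnitaryGroup.adelic (↥(maximalRealSubfield L)) L (IsCMField.complexConj L) 2 (Matrix.diagonal dV))) = Φi := rfl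
      rw [← hcoe] at hint
      have h2 := (integrable_map_equiv Φim _).1 hint
      refine h2.congr (Filter.Eventually.of_forall fun x => ?_)
      show stdExtension 𝒦 (1 / 2) φ s (iotaLeft L e₁ dV hdV (fun _ : Fin 1 => (1 : L)) (fun _ => map_one _) (Φi x)) = _
      rw [hΦi]
    -- (K)
    have hKq : ∀ tt k : (adelicGroupData (↥(maximalRealSubfield L)) L (IsCMField.complexConj L) 2 H).Adelic, UnitaryGroup.archPart (↥(maximalRealSubfield L)) L (IsCMField.complexConj L) 2 H k = 1 →
        (∀ v, UnitaryGroup.evalPlace (↥(maximalRealSubfield L)) L (IsCMField.complexConj L) 2 H v (UnitaryGroup.finPart (↥(maximalRealSubfield L)) L (IsCMField.complexConj L) 2 H k) ∈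
          UnitaryGroup.localInt L (IsCMField.complexConj L) 2 H v) →
        (∀ v ∈ Sf, UnitaryGroup.evalPlace (↥(maximalRealSubfield L)) L (IsCMField.complexConj L) 2 H v (UnitaryGroup.finPart (↥(maximalRealSubfield L)) L (IsCMField.complexConj L) 2 H k) = 1) →
        quotMatrixCoeff (adelicGroupData (↥(maximalRealSubfield L)) L (IsCMField.complexConj L) 2 H) μ wc (fun x => wc (g₀ • x)) (tt * k) = quotMatrixCoeff (adelicGroupData (↥(maximalRealSubfield L)) L (IsCMField.complexConj L) 2 H) μ wc (fun x => wc (g₀ • x)) tt :=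
      fun tt k h1 h2 h3 => K2LiuDoublingZetaGL1Prelim.quotMatrixCoeff_mul_eq_of_toContRep_apply_eq (adelicGroupData (↥(maximalRealSubfield L)) L (IsCMField.complexConj L) 2 H) μ P.space w hwae (hwK k h1 h2 h3) _ tt
    -- (Λ) and (E) from the local datum
    have hΛK : ∀ v, v ∉ Sf → ∀ k ∈ UnitaryGroup.localInt L (IsCMField.complexConj L) 2 H v,
        LambdaLoc L e₁ dV hdV (fun _ : Fin 1 => (1 : L)) (fun _ => map_one _) v (toHeckeCharacter L lam⁻¹) s (iotaLeftLocPi L e₁ dV hdV (fun _ : Fin 1 => (1 : L)) (fun _ => map_one _) v ((localCongr L (IsCMField.complexConj L) g⁻¹ (inv_ne_zero ht) (formCongr_inv_diagonal L H dV t ht g hg) v) k)) = 1 :=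
      fun v hv k hk => (hloc v hv).1 s k hk
    have hΛint : ∀ v, v ∉ Sf →
        Integrable (fun y => LambdaLoc L e₁ dV hdV (fun _ : Fin 1 => (1 : L)) (fun _ => map_one _) v (toHeckeCharacter L lam⁻¹) s (iotaLeftLocPi L e₁ dV hdV (fun _ : Fin 1 => (1 : L)) (fun _ => map_one _) v ((localCongr L (IsCMField.complexConj L) g⁻¹ (inv_ne_zero ht) (formCongr_inv_diagonal L H dV t ht g hg) v) y))) (νv v) :=
      fun v hv => ((hloc v hv).2.2.1 s hs1.le).1
    have hΛbd : ∃ B : ℝ, ∀ T : Finset {v : HeightOneSpectrum (𝓞 ↥(maximalRealSubfield L)) // v ∉ Sf}, ∏ v ∈ T, ∫ y, ‖LambdaLoc L e₁ dV hdV (fun _ : Fin 1 => (1 : L)) (fun _ => map_one _) v.1 (toHeckeCharacter L lam⁻¹) s (iotaLeftLocPi L e₁ dV hdV (fun _ : Fin 1 => (1 : L)) (fun _ => map_one _) v.1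
            (localCongr L (IsCMField.complexConj L) g⁻¹ (inv_ne_zero ht) (formCongr_inv_diagonal L H dV t ht g hg) v.1 y))‖ ∂(νv v.1) ≤ B :=
      K2LiuDoublingZetaGL1LambdaProd.exists_bound_finsetProd' Sf hs1 hC0
        (fun v => ∫ y, ‖LambdaLoc L e₁ dV hdV (fun _ : Fin 1 => (1 : L)) (fun _ => map_one _) v (toHeckeCharacter L lam⁻¹) s (iotaLeftLocPi L e₁ dV hdV (fun _ : Fin 1 => (1 : L)) (fun _ => map_one _) v ((localCongr L (IsCMField.complexConj L) g⁻¹ (inv_ne_zero ht) (formCongr_inv_diagonal L H dV t ht g hg) v) y))‖ ∂(νv v))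
        (fun v _ => integral_nonneg fun _ => norm_nonneg _) (fun v hv => ((hloc v hv).2.2.1 s hs1.le).2)
    have hE : ∀ v, v ∉ Sf → ∀ tt : (adelicGroupData (↥(maximalRealSubfield L)) L (IsCMField.complexConj L) 2 H).Adelic,
        localZeta (νv v) (fun y => LambdaLoc L e₁ dV hdV (fun _ : Fin 1 => (1 : L)) (fun _ => map_one _) v (toHeckeCharacter L lam⁻¹) s (iotaLeftLocPi L e₁ dV hdV (fun _ : Fin 1 => (1 : L)) (fun _ => map_one _) v ((localCongr L (IsCMField.complexConj L) g⁻¹ (inv_ne_zero ht) (formCongr_inv_diagonal L H dV t ht g hg) v) y)))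
            (fun y => quotMatrixCoeff (adelicGroupData (↥(maximalRealSubfield L)) L (IsCMField.complexConj L) 2 H) μ wc (fun x => wc (g₀ • x)) (tt * UnitaryGroup.inclPlaceAdelic (↥(maximalRealSubfield L)) L (IsCMField.complexConj L) 2 H v y)) =
          cfun v s * quotMatrixCoeff (adelicGroupData (↥(maximalRealSubfield L)) L (IsCMField.complexConj L) 2 H) μ wc (fun x => wc (g₀ • x)) tt := by
      intro v hv tt
      obtain ⟨c₀, hEv, hHv⟩ := hEH v hv _ (fun x => wc (g₀ • x)) hw'ae s hs0
      have hc₀ : c₀ = cfun v s := by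
        rw [hcfun, eq_div_iff (hDen v s hs0), hθ₁ v hv, hθ₂ v hv]
        exact hHv
      rw [← hc₀]
      exact hEv tt
    obtain ⟨-, hZ29⟩ := h29 μ ιA (stdExtension 𝒦 (1 / 2) φ s) wc (fun x => wc (g₀ • x)) hwc hwc'c FS
      (fun v y => LambdaLoc L e₁ dV hdV (fun _ : Fin 1 => (1 : L)) (fun _ => map_one _) v (toHeckeCharacter L lam⁻¹) s (iotaLeftLocPi L e₁ dV hdV (fun _ : Fin 1 => (1 : L)) (fun _ => map_one _) v ((localCongr L (IsCMField.complexConj L) g⁻¹ (inv_ne_zero ht) (formCongr_inv_diagonal L H dV t ht g hg) v) y)))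
      (fun v => cfun v s) hF hΛK hΛint hΛbd hfcs hfis hKq hE
    exact hZ29
  -- ★ #32s: holomorphy of `Z_S` on `Re s > 0`
  have h32 := (K2LiuZetaSHolomorphic.zetaSHolomorphic L e₁ dV hdV hdV0 (fun _ : Fin 1 => (1 : L)) (fun _ => map_one _) (fun _ => one_ne_zero) H t ht g hg ιA hιA Sf νinf
    (fun v : Sf => νv v.1) μ (toHeckeCharacter L lam⁻¹) hχu 𝒦 _ hfam hfc Φ hΦc hΦpos hΦ hdecay wc (fun x => wc (g₀ • x)) hwc hwc'c).2
  have hset : {s : ℂ | ((2 : ℕ) : ℝ) / 2 - 1 < s.re} = {s : ℂ | 0 < s.re} := by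
    ext s
    simp only [Set.mem_setOf_eq]
    norm_num
  rw [hset] at h32
  -- `Z_S(½) ≠ 0` (#33s)
  have h33 : zetaS L e₁ dV hdV (fun _ : Fin 1 => (1 : L)) (fun _ => map_one _) H Sf νinf (fun v : Sf => νv v.1) μ ιA (stdExtension 𝒦 (1 / 2) φ (1 / 2)) wc (fun x => wc (g₀ • x)) ≠ 0 := by
    rw [stdExtension_self]
    exact hZ
  -- assembly of the witnesses
  obtain ⟨r, U, s₁, hUo, hUc, hhalf, hs₁, hsub, hr, hr0, hfin⟩ := K2LiuDoublingZetaGL1Assemble.assemble_witnesses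
    (fun s => doublingPairing (adelicGroupData (↥(maximalRealSubfield L)) L (IsCMField.complexConj L) 2 H) μ
          (toQuotFun₂ (adelicGroupData (↥(maximalRealSubfield L)) L (IsCMField.complexConj L) 2 H) (eisensteinPullback L e₁ dV hdV (fun _ : Fin 1 => (1 : L)) (fun _ => map_one _) (adelicGroupData (↥(maximalRealSubfield L)) L (IsCMField.complexConj L) 2 H) ιA (stdExtension 𝒦 (1 / 2) φ s)))
          (fun α => ((w : (adelicGroupData (↥(maximalRealSubfield L)) L (IsCMField.complexConj L) 2 H).L2 μ) : (adelicGroupData (↥(maximalRealSubfield L)) L (IsCMField.complexConj L) 2 H).automorphicQuotient → ℂ) α)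
          (fun α => siegelDeltaCharacter L e₁ dV hdV (fun _ : Fin 1 => (1 : L)) (fun _ => map_one _) (toHeckeCharacter L lam⁻¹) s
            (iotaV L e₁ dV hdV (fun _ : Fin 1 => (1 : L)) (fun _ => map_one _)
              (ιA ((Quotient.out (α : (adelicGroupData (↥(maximalRealSubfield L)) L (IsCMField.complexConj L) 2 H).Adelic ⧸ (adelicGroupData (↥(maximalRealSubfield L)) L (IsCMField.complexConj L) 2 H).quotientSubgroup)) : (adelicGroupData (↥(maximalRealSubfield L)) L (IsCMField.complexConj L) 2 H).Adelic)⁻¹,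
               ιA ((Quotient.out (α : (adelicGroupData (↥(maximalRealSubfield L)) L (IsCMField.complexConj L) 2 H).Adelic ⧸ (adelicGroupData (↥(maximalRealSubfield L)) L (IsCMField.complexConj L) 2 H).quotientSubgroup)) : (adelicGroupData (↥(maximalRealSubfield L)) L (IsCMField.complexConj L) 2 H).Adelic)⁻¹)) *
            ((((P.space.toContRep g₀⁻¹ w : P.space.toSubmodule)) : (adelicGroupData (↥(maximalRealSubfield L)) L (IsCMField.complexConj L) 2 H).L2 μ) : (adelicGroupData (↥(maximalRealSubfield L)) L (IsCMField.complexConj L) 2 H).automorphicQuotient → ℂ) α))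
    (fun s => zetaS L e₁ dV hdV (fun _ : Fin 1 => (1 : L)) (fun _ => map_one _) H Sf νinf (fun v : Sf => νv v.1) μ ιA (stdExtension 𝒦 (1 / 2) φ s) wc (fun x => wc (g₀ • x)))
    (fun s => ∏' v : {v : HeightOneSpectrum (𝓞 ↥(maximalRealSubfield L)) // v ∉ Sf}, cfun v.1 s)
    (fun s => ∏' v : {v : HeightOneSpectrum (𝓞 ↥(maximalRealSubfield L)) // v ∉ Sf},
      ((1 - θ₁ v.1 * (v.1.residueCard : ℂ) ^ (-(2 * s + 2))) * (1 - θ₂ v.1 * (v.1.residueCard : ℂ) ^ (-(2 * s + 1)))))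
    (fun u => ∏' w : {w : HeightOneSpectrum (𝓞 L) // w ∉ {w : HeightOneSpectrum (𝓞 L) | w.under (𝓞 ↥(maximalRealSubfield L)) ∈ Sf}},
      ((1 - ((w.1.residueCard : ℂ) ^ (-u)))⁻¹ * (1 - ((muAlg L lam)⁻¹ * (HeckeCharacter.galConj (IsCMField.complexConj L) (muAlg L lam) *
        HeckeCharacter.checkOfChi (complexConj_mul_complexConj' L) χ)).valueAtUniformizer w.1 * ((w.1.residueCard : ℂ) ^ (-u)))⁻¹))
    (max 1 σ₀) (le_max_left _ _) h29' (fun s hs => (h30 s hs).2) hBdiff hBne h32 h33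
  -- `Ψ` is unramified off `S_L`
  have hΨS : ∀ w : HeightOneSpectrum (𝓞 L), w ∉ {w : HeightOneSpectrum (𝓞 L) | w.under (𝓞 ↥(maximalRealSubfield L)) ∈ Sf} → ((muAlg L lam)⁻¹ * (HeckeCharacter.galConj (IsCMField.complexConj L) (muAlg L lam) * HeckeCharacter.checkOfChi (complexConj_mul_complexConj' L) χ)).IsUnramifiedAt w := by
    intro w hw
    have hv : w.under (𝓞 ↥(maximalRealSubfield L)) ∉ Sf := hw
    have hwbar : (IsCMField.complexConj L • w).under (𝓞 ↥(maximalRealSubfield L)) = w.under (𝓞 ↥(maximalRealSubfield L)) :=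
      HeightOneSpectrum.under_algEquiv_smul (F := ↥(maximalRealSubfield L)) L (IsCMField.complexConj L) w
    exact K2LiuDoublingZetaGL1Character.isUnramifiedAt_character L lam χ w (hunr _ hv ⟨w, rfl⟩).1 (hunr _ hv ⟨_, hwbar⟩).1
      (hunr _ hv ⟨w, rfl⟩).2.2
  exact ⟨𝒦, stdExtension 𝒦 (1 / 2) φ, h𝒦, hfam, hfc, (w : (adelicGroupData (↥(maximalRealSubfield L)) L (IsCMField.complexConj L) 2 H).L2 μ), w.2,
    (((P.space.toContRep g₀⁻¹ w : P.space.toSubmodule)) : (adelicGroupData (↥(maximalRealSubfield L)) L (IsCMField.complexConj L) 2 H).L2 μ), (P.space.toContRep g₀⁻¹ w).2,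
    ((muAlg L lam)⁻¹ * (HeckeCharacter.galConj (IsCMField.complexConj L) (muAlg L lam) * HeckeCharacter.checkOfChi (complexConj_mul_complexConj' L) χ)), hΨu, K2LiuDoublingZetaGL1Character.character_posRealIdele L lam χ,
    {w : HeightOneSpectrum (𝓞 L) | w.under (𝓞 ↥(maximalRealSubfield L)) ∈ Sf}, K2LiuDoublingZetaGL1Prelim.finite_setOf_under_mem Sf, hΨS,
    r, U, s₁, hUo, hUc, hhalf, hs₁, hsub, hr, hr0, fun s hs => hfin s hs⟩

end Summit.HodgeConjecture.HodgeConjecture.Cruxes.HLiu418.K2LiuDoublingZetaGL1Euler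

end
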